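import Literature.NumberTheory.ComplexMultiplication.SexticOcticSlotOrderThree
import HarnessLib

/-!
# A sextic slot against an octic slot, II: index calculus on the frames of an element of order three

COR-CM (cell `pub-hodgecm2`, binder seat `b16` gen 47, count-neutral claim CM34-COMPLETE, file F2; theorems only, no
definition, no named fact, no `sorry`).  Continuation of `SexticOcticSlotOrderThree` (a group `G` acting on `X`,
`|X| = 6`, and `Y`, `|Y| = 8`, with a commuting fixed-point-free involution `ρ`; an element `c` with `c³ = 1`).  The
frames of F1 are read as bijections

* `Fin 6 → X`, `i ↦ (x₀, cx₀, c²x₀, ρx₀, ρcx₀, ρc²x₀)_i`, on which `ρ` acts by the index permutation `(3 4 5 0 1 2)` and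
  `c` by `(1 2 0 4 5 3)` (`frameX_index`);
* `Fin 8 → Y`, `i ↦ (y₀, ρy₀, y₁, cy₁, c²y₁, ρy₁, ρcy₁, ρc²y₁)_i`, on which `ρ` acts by `(1 0 5 6 7 2 3 4)` and `c` by
  `(0 1 3 4 2 6 7 5)` (`frameY_index`),

so that every point-chasing step of the (3,4) cell becomes a finite computation on indices: elementary odd vectors
evaluate by `Pi.single` on indices (`single_frame_apply`), a `ρ`-odd weight is determined by its values at
`x₀, cx₀, c²x₀` resp. `y₀, y₁, cy₁, c²y₁` (`eq_zero_of_frame₆`, `eq_zero_of_frame₈`), and EVERY `g ∈ G` acts on a frame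
through an injective index map commuting with the index conjugation (`exists_indexMap₆`, `exists_indexMap₈`).  The last
section has the two pieces of linear algebra used downstream: a `G`-stable LINE with an equivariant injection carries a
shared eigenvector (`exists_shared_eigen_of_finrank_eq_one`), and a linear functional has a non-zero zero on every
subspace of dimension `≥ 2` (`exists_mem_ne_zero_map_eq_zero`).

## References

* [Dodson1984] B. Dodson, *The structure of Galois groups of CM-fields*, Trans. AMS 283 (1984), §5.1.1–§5.1.2.
* [Serre1977] J.-P. Serre, *Linear Representations of Finite Groups*, GTM 42, §2.2 (Schur's lemma for a stable line).

Provenance: Literature home (namespace `Literature.NumberTheory.ComplexMultiplication.SexticOctic`) of the Summits-side `CorCM/SexticOcticSlotFrameIndex` (cell `pub-hodgecm2`, COR-CM; all its imports are `Literature/`, Mathlib and the already re-homed `SexticOcticSlotOrderThree`), which `Literature/` may not import; theorems only, no named fact, no definition. Nothing here bears on `HC_CM`. Lane `lit-hodgefound` (Layer A3: CM types, their Kubota ranks and Galois combinatorics), seat p20.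
-/

noncomputable section

namespace Literature.NumberTheory.ComplexMultiplication.SexticOctic

open Literature.NumberTheory.ComplexMultiplication

variable {G : Type*} [Group G]

/-! ## §1 The two frames as index bijections -/

section IndexX

variable {X : Type*} [MulAction G X] [Fintype X] [DecidableEq X] {ρ : G} {Φ : Set X}

/-- **The `X`-frame as an index bijection** `Fin 6 → X`: injective, surjective, `ρ` acts by `(3 4 5 0 1 2)` and `c` by
`(1 2 0 4 5 3)`. [cite: Dodson1984, §5.1.2] -/
theorem frameX_index (hΦ : IsCMTypeWith ρ Φ) (hX : Fintype.card X = 6) {c : G}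
    (hc3 : ∀ x : X, c • c • c • x = x) {x₀ : X} (hx₀ : c • x₀ ≠ x₀) :
    Function.Injective ![x₀, c • x₀, c • c • x₀, ρ • x₀, ρ • c • x₀, ρ • c • c • x₀] ∧
    Function.Surjective ![x₀, c • x₀, c • c • x₀, ρ • x₀, ρ • c • x₀, ρ • c • c • x₀] ∧
    (∀ i : Fin 6, ρ • ![x₀, c • x₀, c • c • x₀, ρ • x₀, ρ • c • x₀, ρ • c • c • x₀] i =
      ![x₀, c • x₀, c • c • x₀, ρ • x₀, ρ • c • x₀, ρ • c • c • x₀] (![3, 4, 5, 0, 1, 2] i)) ∧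
    (∀ i : Fin 6, c • ![x₀, c • x₀, c • c • x₀, ρ • x₀, ρ • c • x₀, ρ • c • c • x₀] i =
      ![x₀, c • x₀, c • c • x₀, ρ • x₀, ρ • c • x₀, ρ • c • c • x₀] (![1, 2, 0, 4, 5, 3] i)) := by
  have hcases := frameX_cases hΦ hX hc3 hx₀
  have hsurj : Function.Surjective ![x₀, c • x₀, c • c • x₀, ρ • x₀, ρ • c • x₀, ρ • c • c • x₀] := by
    intro x
    rcases hcases x with rfl | rfl | rfl | rfl | rfl | rfl
    · exact ⟨0, rfl⟩
    · exact ⟨1, rfl⟩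
    · exact ⟨2, rfl⟩
    · exact ⟨3, rfl⟩
    · exact ⟨4, rfl⟩
    · exact ⟨5, rfl⟩
  have hinj : Function.Injective ![x₀, c • x₀, c • c • x₀, ρ • x₀, ρ • c • x₀, ρ • c • c • x₀] :=
    (Finite.injective_iff_surjective_of_equiv (Fintype.equivFinOfCardEq hX).symm).2 hsurj
  refine ⟨hinj, hsurj, fun i => ?_, fun i => ?_⟩
  · fin_cases i
    · rfl
    · rfl
    · rfl
    · exact hΦ.invol x₀
    · exact hΦ.invol (c • x₀)
    · exact hΦ.invol (c • c • x₀)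
  · fin_cases i
    · rfl
    · rfl
    · exact hc3 x₀
    · exact hΦ.comm c x₀
    · exact hΦ.comm c (c • x₀)
    · show c • ρ • c • c • x₀ = ρ • x₀
      rw [hΦ.comm, hc3]

end IndexX

section IndexY

variable {Y : Type*} [MulAction G Y] [Fintype Y] [DecidableEq Y] {ρ : G} {Ψ : Set Y}

/-- **The `Y`-frame as an index bijection** `Fin 8 → Y`: injective, surjective, `ρ` acts by `(1 0 5 6 7 2 3 4)` and
`c` by `(0 1 3 4 2 6 7 5)` — one fixed pair, three cycled pairs. [cite: Dodson1984, §5.1.1] -/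
theorem frameY_index (hΨ : IsCMTypeWith ρ Ψ) (hY : Fintype.card Y = 8) {c : G}
    (hc3 : ∀ y : Y, c • c • c • y = y) {y₀ y₁ : Y} (hy₀ : c • y₀ = y₀) (hy₁ : c • y₁ ≠ y₁) :
    Function.Injective ![y₀, ρ • y₀, y₁, c • y₁, c • c • y₁, ρ • y₁, ρ • c • y₁, ρ • c • c • y₁] ∧
    Function.Surjective ![y₀, ρ • y₀, y₁, c • y₁, c • c • y₁, ρ • y₁, ρ • c • y₁, ρ • c • c • y₁] ∧
    (∀ i : Fin 8, ρ • ![y₀, ρ • y₀, y₁, c • y₁, c • c • y₁, ρ • y₁, ρ • c • y₁, ρ • c • c • y₁] i =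
      ![y₀, ρ • y₀, y₁, c • y₁, c • c • y₁, ρ • y₁, ρ • c • y₁, ρ • c • c • y₁] (![1, 0, 5, 6, 7, 2, 3, 4] i)) ∧
    (∀ i : Fin 8, c • ![y₀, ρ • y₀, y₁, c • y₁, c • c • y₁, ρ • y₁, ρ • c • y₁, ρ • c • c • y₁] i =
      ![y₀, ρ • y₀, y₁, c • y₁, c • c • y₁, ρ • y₁, ρ • c • y₁, ρ • c • c • y₁] (![0, 1, 3, 4, 2, 6, 7, 5] i)) := by
  have hcases := frameY_cases hΨ hY hc3 hy₀ hy₁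
  have hsurj : Function.Surjective ![y₀, ρ • y₀, y₁, c • y₁, c • c • y₁, ρ • y₁, ρ • c • y₁, ρ • c • c • y₁] := by
    intro y
    rcases hcases y with rfl | rfl | rfl | rfl | rfl | rfl | rfl | rfl
    · exact ⟨0, rfl⟩
    · exact ⟨1, rfl⟩
    · exact ⟨2, rfl⟩
    · exact ⟨3, rfl⟩
    · exact ⟨4, rfl⟩
    · exact ⟨5, rfl⟩
    · exact ⟨6, rfl⟩
    · exact ⟨7, rfl⟩
  have hinj : Function.Injective ![y₀, ρ • y₀, y₁, c • y₁, c • c • y₁, ρ • y₁, ρ • c • y₁, ρ • c • c • y₁] :=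
    (Finite.injective_iff_surjective_of_equiv (Fintype.equivFinOfCardEq hY).symm).2 hsurj
  refine ⟨hinj, hsurj, fun i => ?_, fun i => ?_⟩
  · fin_cases i
    · rfl
    · exact hΨ.invol y₀
    · rfl
    · rfl
    · rfl
    · exact hΨ.invol y₁
    · exact hΨ.invol (c • y₁)
    · exact hΨ.invol (c • c • y₁)
  · fin_cases i
    · exact hy₀
    · show c • ρ • y₀ = ρ • y₀
      rw [hΨ.comm, hy₀]
    · rfl
    · rfl
    · exact hc3 y₁
    · exact hΨ.comm c y₁
    · exact hΨ.comm c (c • y₁)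
    · show c • ρ • c • c • y₁ = ρ • y₁
      rw [hΨ.comm, hc3]

end IndexY

/-! ## §2 Index calculus on a frame (any length) -/

section Calculus

variable {Z : Type*} [MulAction G Z] {n : ℕ} {e : Fin n → Z}

/-- **Elementary vectors evaluate on indices**: `δ_{e i}(e j) = [j = i]`. [cite: Dodson1984, §5.1.1] -/
theorem single_frame_apply [DecidableEq Z] (he : Function.Injective e) (i j : Fin n) (a : ℚ) :
    (Pi.single (e i) a : Z → ℚ) (e j) = if j = i then a else 0 := by
  simp only [Pi.single_apply, he.eq_iff]

/-- **A function vanishing on a surjective frame is zero.** [cite: Dodson1984, §5.1.1] -/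
theorem eq_zero_of_forall_frame (hsurj : Function.Surjective e) {f : Z → ℚ} (h : ∀ i, f (e i) = 0) : f = 0 := by
  funext z
  obtain ⟨i, rfl⟩ := hsurj z
  exact h i

/-- **Two functions agreeing on a surjective frame are equal.** [cite: Dodson1984, §5.1.1] -/
theorem eq_of_forall_frame (hsurj : Function.Surjective e) {f f' : Z → ℚ} (h : ∀ i, f (e i) = f' (e i)) : f = f' := by
  funext z
  obtain ⟨i, rfl⟩ := hsurj z
  exact h i

/-- **Every `g ∈ G` acts on a frame through an injective index map commuting with the index action of `ρ`.**
(`G` commutes with `ρ`; the frame is a bijection.) [cite: Dodson1984, §5.1.1] -/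
theorem exists_indexMap (he : Function.Injective e) (hsurj : Function.Surjective e) {ρ : G} {r : Fin n → Fin n}
    (hρe : ∀ i, ρ • e i = e (r i)) (hcomm : ∀ (g : G) (z : Z), g • ρ • z = ρ • g • z) (g : G) :
    ∃ π : Fin n → Fin n, (∀ i, g • e i = e (π i)) ∧ Function.Injective π ∧ ∀ i, π (r i) = r (π i) := by
  choose π hπ using fun i => hsurj (g • e i)
  refine ⟨π, fun i => (hπ i).symm, fun i j hij => ?_, fun i => he ?_⟩
  · apply he
    apply smul_left_cancel g
    rw [← hπ i, ← hπ j, hij]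
  · rw [hπ (r i), ← hρe i, hcomm, ← hπ i, hρe]

end Calculus

/-! ## §3 Odd weights on the two frames -/

section OddX

variable {X : Type*} [MulAction G X] {ρ : G} {e : Fin 6 → X}

/-- **An odd weight on `X` is its value vector `(p₀, p₁, p₂, −p₀, −p₁, −p₂)` on the frame.** [cite: Dodson1984, §5.1.2] -/
theorem apply_frame₆ (hρe : ∀ i, ρ • e i = e (![3, 4, 5, 0, 1, 2] i)) {p : X → ℚ}
    (hp : p ∈ antiWeights (E := X) ρ) (i : Fin 6) :
    p (e i) = ![p (e 0), p (e 1), p (e 2), -p (e 0), -p (e 1), -p (e 2)] i := by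
  have hodd : ∀ j, p (ρ • e j) = -p (e j) := fun j => (mem_antiWeights_iff'.1 hp) (e j)
  fin_cases i
  · rfl
  · rfl
  · rfl
  · have := hodd 0; rw [hρe] at this; exact this
  · have := hodd 1; rw [hρe] at this; exact this
  · have := hodd 2; rw [hρe] at this; exact this

/-- **An odd weight on `X` vanishing at `x₀, cx₀, c²x₀` is zero.** [cite: Dodson1984, §5.1.2] -/
theorem eq_zero_of_frame₆ (hsurj : Function.Surjective e) (hρe : ∀ i, ρ • e i = e (![3, 4, 5, 0, 1, 2] i))
    {p : X → ℚ} (hp : p ∈ antiWeights (E := X) ρ) (h0 : p (e 0) = 0) (h1 : p (e 1) = 0) (h2 : p (e 2) = 0) :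
    p = 0 := by
  refine eq_zero_of_forall_frame hsurj fun i => ?_
  rw [apply_frame₆ hρe hp i]
  fin_cases i <;> simp [h0, h1, h2]

/-- **The trace along `c` of an odd weight with `p(x₀) + p(cx₀) + p(c²x₀) = 0` vanishes**: `p + p∘c + p∘c² = 0`.
[cite: Dodson1984, §5.1.2] -/
theorem add_comp_add_comp_eq_zero₆ (hsurj : Function.Surjective e) (hρe : ∀ i, ρ • e i = e (![3, 4, 5, 0, 1, 2] i))
    {c : G} (hce : ∀ i, c • e i = e (![1, 2, 0, 4, 5, 3] i)) {p : X → ℚ} (hp : p ∈ antiWeights (E := X) ρ)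
    (hs : p (e 0) + p (e 1) + p (e 2) = 0) :
    (p + (fun x => p (c • x)) + fun x => p (c • c • x)) = 0 := by
  refine eq_zero_of_forall_frame hsurj fun i => ?_
  simp only [Pi.add_apply]
  rw [hce, hce, apply_frame₆ hρe hp, apply_frame₆ hρe hp (![1, 2, 0, 4, 5, 3] i),
    apply_frame₆ hρe hp (![1, 2, 0, 4, 5, 3] (![1, 2, 0, 4, 5, 3] i))]
  fin_cases i <;> simp <;> linarith

/-- The trace along `c` is `c`-invariant in each coordinate: `(p∘c)(x₀) + (p∘c)(cx₀) + (p∘c)(c²x₀) = p(x₀) + p(cx₀) +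
p(c²x₀)`. [cite: Dodson1984, §5.1.1] -/
theorem sum_comp_eq_sum₆ {c : G} (hce : ∀ i, c • e i = e (![1, 2, 0, 4, 5, 3] i)) (p : X → ℚ) :
    p (c • e 0) + p (c • e 1) + p (c • e 2) = p (e 0) + p (e 1) + p (e 2) := by
  rw [hce, hce, hce]
  simp only [Matrix.cons_val_zero, Matrix.cons_val_one, Matrix.cons_val]
  ring

end OddX

section OddY

variable {Y : Type*} [MulAction G Y] {ρ : G} {e : Fin 8 → Y}

/-- **An odd weight on `Y` is its value vector `(a, −a, b₀, b₁, b₂, −b₀, −b₁, −b₂)` on the frame.**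
[cite: Dodson1984, §5.1.1] -/
theorem apply_frame₈ (hρe : ∀ i, ρ • e i = e (![1, 0, 5, 6, 7, 2, 3, 4] i)) {q : Y → ℚ}
    (hq : q ∈ antiWeights (E := Y) ρ) (i : Fin 8) :
    q (e i) = ![q (e 0), -q (e 0), q (e 2), q (e 3), q (e 4), -q (e 2), -q (e 3), -q (e 4)] i := by
  have hodd : ∀ j, q (ρ • e j) = -q (e j) := fun j => (mem_antiWeights_iff'.1 hq) (e j)
  fin_cases i
  · rfl
  · have := hodd 0; rw [hρe] at this; exact this
  · rfl
  · rfl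
  · rfl
  · have := hodd 2; rw [hρe] at this; exact this
  · have := hodd 3; rw [hρe] at this; exact this
  · have := hodd 4; rw [hρe] at this; exact this

/-- **An odd weight on `Y` vanishing at `y₀, y₁, cy₁, c²y₁` is zero.** [cite: Dodson1984, §5.1.1] -/
theorem eq_zero_of_frame₈ (hsurj : Function.Surjective e) (hρe : ∀ i, ρ • e i = e (![1, 0, 5, 6, 7, 2, 3, 4] i))
    {q : Y → ℚ} (hq : q ∈ antiWeights (E := Y) ρ) (h0 : q (e 0) = 0) (h2 : q (e 2) = 0) (h3 : q (e 3) = 0)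
    (h4 : q (e 4) = 0) : q = 0 := by
  refine eq_zero_of_forall_frame hsurj fun i => ?_
  rw [apply_frame₈ hρe hq i]
  fin_cases i <;> simp [h0, h2, h3, h4]

/-- **Two odd weights on `Y` agreeing at `y₀, y₁, cy₁, c²y₁` are equal.** [cite: Dodson1984, §5.1.1] -/
theorem eq_of_frame₈ (hsurj : Function.Surjective e) (hρe : ∀ i, ρ • e i = e (![1, 0, 5, 6, 7, 2, 3, 4] i))
    {q q' : Y → ℚ} (hq : q ∈ antiWeights (E := Y) ρ) (hq' : q' ∈ antiWeights (E := Y) ρ)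
    (h0 : q (e 0) = q' (e 0)) (h2 : q (e 2) = q' (e 2)) (h3 : q (e 3) = q' (e 3)) (h4 : q (e 4) = q' (e 4)) :
    q = q' := by
  rw [← sub_eq_zero]
  exact eq_zero_of_frame₈ hsurj hρe (Submodule.sub_mem _ hq hq') (by simp [h0]) (by simp [h2]) (by simp [h3])
    (by simp [h4])

/-- **The trace along `c` on `Y`**: if `q + q∘c + q∘c² = 0` then `q(y₀) = 0` (the fixed coordinate is tripled) and
`q(y₁) + q(cy₁) + q(c²y₁) = 0`. [cite: Dodson1984, §5.1.1] -/
theorem apply_eq_zero_of_add_comp_add_comp_eq_zero₈ {c : G} (hce : ∀ i, c • e i = e (![0, 1, 3, 4, 2, 6, 7, 5] i))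
    {q : Y → ℚ} (h : (q + (fun y => q (c • y)) + fun y => q (c • c • y)) = 0) :
    q (e 0) = 0 ∧ q (e 2) + q (e 3) + q (e 4) = 0 := by
  have h0 := congrFun h (e 0)
  have h2 := congrFun h (e 2)
  simp only [Pi.add_apply, Pi.zero_apply] at h0 h2
  rw [hce, hce] at h0 h2
  simp only [Matrix.cons_val_zero, Matrix.cons_val] at h0 h2
  constructor
  · linarith
  · linarith

end OddY

/-! ## §4 Two pieces of linear algebra -/

section LinAlg

variable {V W : Type*} [AddCommGroup V] [Module ℚ V] [AddCommGroup W] [Module ℚ W]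

/-- **A linear functional has a non-zero zero on every subspace of dimension `≥ 2`.** [cite: Dodson1984, §5.1.1] -/
theorem exists_mem_ne_zero_map_eq_zero {P : Submodule ℚ V} (h2 : 2 ≤ Module.finrank ℚ P) (φ : V →ₗ[ℚ] ℚ) :
    ∃ p ∈ P, p ≠ 0 ∧ φ p = 0 := by
  by_contra H
  push Not at H
  have hinj : Function.Injective (φ.domRestrict P) := by
    rw [← LinearMap.ker_eq_bot, LinearMap.ker_eq_bot']
    intro p hp
    by_contra hp0
    exact H p p.2 (fun h => hp0 (Subtype.ext h)) hp
  have := LinearMap.finrank_le_finrank_of_injective hinj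
  rw [Module.finrank_self] at this
  omega

variable {X Y : Type*} [MulAction G X] [MulAction G Y]

/-- **A `G`-stable line with an equivariant injection carries a SHARED EIGENVECTOR** (Schur for a line): if
`dim P = 1`, `P` is `G`-stable and `T` is `G`-equivariant and injective on `P`, then a generator `f` of `P` and its image
`T f` are non-zero eigenvectors of one and the same `χ : G → ℚ`. [cite: Serre1977, §2.2] -/
theorem exists_shared_eigen_of_finrank_eq_one {P : Submodule ℚ (X → ℚ)} (hP1 : Module.finrank ℚ P = 1)
    (hPst : ∀ g : G, ∀ f ∈ P, (fun x => f (g • x)) ∈ P) (T : (X → ℚ) →ₗ[ℚ] (Y → ℚ))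
    (hT : ∀ g : G, ∀ f ∈ P, T (fun x => f (g • x)) = fun y => T f (g • y))
    (hTinj : ∀ f ∈ P, T f = 0 → f = 0) :
    ∃ (χ : G → ℚ) (f : X → ℚ), f ∈ P ∧ f ≠ 0 ∧ T f ≠ 0 ∧ (∀ g : G, (fun x => f (g • x)) = χ g • f) ∧
      ∀ g : G, (fun y => T f (g • y)) = χ g • T f := by
  obtain ⟨⟨f, hfP⟩, hf0, hgen⟩ := finrank_eq_one_iff'.1 hP1
  have hf0' : f ≠ 0 := fun h => hf0 (Subtype.ext h)
  have hline : ∀ g : G, ∃ a : ℚ, (fun x => f (g • x)) = a • f := by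
    intro g
    obtain ⟨a, ha⟩ := hgen ⟨_, hPst g f hfP⟩
    exact ⟨a, by simpa using congrArg Subtype.val ha.symm⟩
  choose χ hχ using hline
  refine ⟨χ, f, hfP, hf0', fun h => hf0' (hTinj f hfP h), hχ, fun g => ?_⟩
  rw [← hT g f hfP, hχ g, map_smul]

end LinAlg

end Literature.NumberTheory.ComplexMultiplication.SexticOctic

end
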